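import Mathlib.Algebra.Group.ULift
import Mathlib.Data.ULift
import Mathlib.GroupTheory.SpecificGroups.Dihedral
import Mathlib.Topology.Algebra.Category.ProfiniteGrp.Basic
import Literature.AnabelianGeometry.AbsoluteAnabelian.AbsTopII.InertiaDecompositionCore
import Literature.AnabelianGeometry.AbsoluteAnabelian.AbsTopII.DecompositionGroups

/-!
# [AbsTopII] Prop 1.3 (v), (vi), (vii) AS TYPED: universal closures REFUTED, smooth-case instances PROVED

S. Mochizuki, *Topics in Absolute Anabelian Geometry II* [AbsTopII] (bib `MochizukiAbsTopII2013`;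
locators = PDF pages of the kurims manuscript `paper:url-585b8d0ad0d9`), §1, Def 1.2 (ii) p. 10,
Proposition 1.3 (v), (vi), (vii) p. 12.

The cell types Prop 1.3 (v), (vi), (vii) as the PREDICATES `DPSCData.Prop13v`, `DPSCData.Prop13vi`,
`DPSCData.Prop13vii` (abc-iut-L4-t4, `AbsTopII/DecompositionGroups.lean`, p404475; FACT-LIST rows
F-0278, F-0279, F-0280) on ABSTRACT DPSC data `X : DPSCData` — a profinite group `Π_H`, closed normal
subgroups `Π_𝔾 ≤ Π_I`, and CHOSEN verticial / nodal / cuspidal subgroups `Π_v, Π_e ≤ Π_𝔾` — with the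
REAL definitions `D_v := N_{Π_H}(Π_v)`, `I_v := Z_{Π_I}(Π_v)`, `D_e := N_{Π_H}(Π_e)`, `I_e := Z_{Π_I}(Π_e)`
of Def 1.2 (ii).  The structure records no geometry (no stable log curve, no semi-graph of
anabelioids, no outer action of `H` on `𝔾`), so each row is a HYPOTHESIS ON DATA, admissible at
named instances only (FACT-LIST rule R5), not a closed fact.  This proof-only file (no definitions)
records the kernel events that classify the three rows:

* **universal closures REFUTED** (`DPSCData.not_forall_prop13v`, `not_forall_prop13vi`,
  `not_forall_prop13vii`): explicit finite DPSC data — `Π_H = Π_I = Π_𝔾 =` the dihedral group of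
  order `6` with the discrete topology — violate (v) (take `Π_v := 1`: then `D_v ∩ Π_𝔾 = Π_𝔾 ≠ Π_v`),
  (vi) (two vertices: `D_v` is open in a finite `Π_H`) and (vii) (a node with `Π_e := Π_𝔾`: then
  `I_e = Z(Π_𝔾) ∌ r` while `r ∈ D_e ∩ Π_I = Π_𝔾`);
* **smooth-case instances PROVED** (pure group theory, NO geometric input): for every DPSC datum
  whose verticial subgroups are all of `Π_𝔾` — the datum of a SMOOTH stable log curve, whose dual
  semi-graph `𝔾` has a single vertex `v` and no nodes, so that `Π_v = Π_𝔾` ([CombGC] Def 1.1 (ii)) —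
  Prop 1.3 (v) holds (`prop13v_of_vertSub_eq`: `D_v = Π_H`, and `I_v = Z_{Π_H}(Π_𝔾) ∩ Π_I` is normal,
  so `C_{Π_H}(I_v) = N_{Π_H}(I_v) = Π_H`); if moreover `𝔾` has at most one vertex, (vi) holds
  (`prop13vi_of_vertSub_eq`); if `𝔾` has no edges at all (smooth PROPER curve), (vii) holds
  vacuously (`prop13vii_of_isEmpty`); hence the three typed predicates are jointly satisfied by
  data with `Π_H ≠ 1` (`exists_prop13v_prop13vi_prop13vii`).

The general (singular) case is NOT touched here: it is exactly the content of [CombGC] Prop 1.2 and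
of the graphicity of `H ↷ 𝔾`, supplied as explicit hypotheses by the cell's conditional derivations
`DPSCData.prop13v_of_inputs`, `prop13vii_of_inputs` (`AbsTopII/InertiaDecompositionProofs.lean`,
p425615) and `prop13vi_of_inputs` (`AbsTopII/InertiaDecompositionOpenness.lean`, p425634).
HONEST FRAMING: a refuted universal closure says the row is a hypothesis on data, not that anything
in print is false; the smooth-case theorems are classical group theory about a refereed,
undisputed paper; nothing here bears on [IUTchIII] Cor 3.12.
-/

open scoped Pointwise

namespace Literature.AnabelianGeometry.AbsoluteAnabelian

universe u

/-! ## Generic group theory -/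

section GroupTheory

variable {G : Type u} [Group G]

/-- The commensurator of a NORMAL subgroup is the whole group: "we have inclusions
`H, Z_G(H) ⊆ N_G(H) ⊆ C_G(H)`" ([SemiAnbd] §0 p. 5) with `N_G(H) = G`.
[cite: MochizukiSemiAnbd2006, §0 p.5] -/
theorem commensurator_eq_top_of_normal (H : Subgroup G) [H.Normal] :
    Subgroup.Commensurable.commensurator H = ⊤ :=
  top_le_iff.mp ((Subgroup.normalizer_eq_top (H := H)).symm.le.trans
    (Anabelioids.normalizer_le_commensurator H))

/-- The whole group is commensurably terminal in itself: `C_G(G) = G` ([AbsAnab] Def 0.1 (iii),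
the case `H = G`; private twin of abc-iut-f-097's `isCommensurablyTerminal_top` in
`GaloisSectionsFactsThm13iiSchema.lean`, kept build-independent). [cite: MochizukiAbsAnab2004, Def 0.1 (iii) p.4] -/
private theorem top_isCommensurablyTerminal : IsCommensurablyTerminal (⊤ : Subgroup G) :=
  ⟨commensurator_eq_top_of_normal ⊤⟩

end GroupTheory

namespace DPSCData

variable (X : DPSCData.{u})

/-! ## The smooth case: `Π_v = Π_𝔾` (one vertex, no nodes) -/

/-- If `Π_v = Π_𝔾` (smooth case), then `D_v = N_{Π_H}(Π_𝔾) = Π_H`, `Π_𝔾` being normal in `Π_H`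
(Def 1.2 (ii): `Π_H = Π_𝔾 ⋊^{out} H`). [cite: MochizukiAbsTopII2013, Def 1.2 (ii) p.10] -/
theorem Dv_eq_top_of_vertSub_eq {v : X.Vert} (h : X.vertSub v = X.PiG) : X.Dv v = ⊤ := by
  haveI := X.normal_PiG
  unfold DPSCData.Dv
  rw [h]
  exact Subgroup.normalizer_eq_top (H := X.PiG)

/-- If `Π_v = Π_𝔾` (smooth case), then `I_v = Z_{Π_I}(Π_𝔾) = Z_{Π_H}(Π_𝔾) ∩ Π_I` is NORMAL in `Π_H`
(the centraliser of a normal subgroup is normal; `Π_I` is normal).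
[cite: MochizukiAbsTopII2013, Def 1.2 (ii) p.10] -/
theorem normal_Iv_of_vertSub_eq {v : X.Vert} (h : X.vertSub v = X.PiG) : (X.Iv v).Normal := by
  haveI := X.normal_PiG
  haveI := X.normal_PiI
  unfold DPSCData.Iv
  rw [h]
  infer_instance

/-- **[AbsTopII] Prop 1.3 (v) in the SMOOTH case, PROVED** (no geometric input): if every verticial
subgroup is all of `Π_𝔾` — the DPSC datum of a smooth stable log curve (`𝔾` has one vertex and no
nodes, `Π_v = Π_𝔾`) — then "`D_v = C_{Π_H}(I_v) = N_{Π_H}(I_v)` is commensurably terminal in `Π_H`;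
… `D_v ∩ Π_𝔾 = Π_v` is commensurably terminal in `Π_𝔾`": indeed `D_v = Π_H`, `I_v ⊴ Π_H`, and a
normal subgroup has commensurator and normaliser `Π_H`.  Conclusion: literally the typed predicate
`DPSCData.Prop13v` (F-0278) at such data. [cite: MochizukiAbsTopII2013, Prop 1.3 (v) p.12] -/
theorem prop13v_of_vertSub_eq (h : ∀ v : X.Vert, X.vertSub v = X.PiG) : X.Prop13v := by
  intro v
  have hD : X.Dv v = ⊤ := X.Dv_eq_top_of_vertSub_eq (h v)
  haveI : (X.Iv v).Normal := X.normal_Iv_of_vertSub_eq (h v)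
  refine ⟨?_, ?_, ?_, ?_, ?_⟩
  · rw [hD, commensurator_eq_top_of_normal (X.Iv v)]
  · rw [hD, Subgroup.normalizer_eq_top]
  · rw [hD]; exact top_isCommensurablyTerminal
  · rw [hD, top_inf_eq, h v]
  · rw [h v, Subgroup.subgroupOf_self]; exact top_isCommensurablyTerminal

/-- **[AbsTopII] Prop 1.3 (vi) in the SMOOTH case, PROVED** (no geometric input): if `𝔾` has at most
one vertex and `Π_v = Π_𝔾`, then "the image of `D_v` in `H` is open" (it is all of `H = Π_H/Π_𝔾`,
since `D_v = Π_H`), and the clause "if `𝔾` has more than one vertex, then `D_v` is not open in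
`Π_H`" is vacuous.  Conclusion: literally `DPSCData.Prop13vi` (F-0279) at such data.
[cite: MochizukiAbsTopII2013, Prop 1.3 (vi) p.12] -/
theorem prop13vi_of_vertSub_eq (hV : ∀ v w : X.Vert, v = w) (h : ∀ v : X.Vert, X.vertSub v = X.PiG) :
    X.Prop13vi := by
  haveI := X.normal_PiG
  intro v
  refine ⟨?_, ?_⟩
  · rw [X.Dv_eq_top_of_vertSub_eq (h v),
      Subgroup.map_top_of_surjective _ (QuotientGroup.mk'_surjective _), Subgroup.coe_top]
    exact isOpen_univ
  · rintro ⟨w, hw⟩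
    exact (hw (hV w v)).elim

/-- **[AbsTopII] Prop 1.3 (vii) for a smooth PROPER curve** (`𝔾` has no edges: no nodes, no
cusps): both clauses quantify over edges, so the typed predicate `DPSCData.Prop13vii` (F-0280) holds
vacuously at such data.  (For cusps `e` the clause "`D_e = C_{Π_H}(Π_e)` commensurably terminal" is
NOT free: it is [CombGC] Prop 1.2 + graphicity, cf. `DPSCData.prop13vii_of_inputs`.)
[cite: MochizukiAbsTopII2013, Prop 1.3 (vii) p.12] -/
theorem prop13vii_of_isEmpty (hN : IsEmpty X.Node) (hC : IsEmpty X.Cusp) : X.Prop13vii :=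
  ⟨fun e => isEmptyElim e, fun e => isEmptyElim e⟩

/-- **Joint non-vacuity of the three typed predicates**: there is a DPSC datum with `Π_H ≠ 1` and a
vertex at which `Prop13v`, `Prop13vi`, `Prop13vii` hold simultaneously — the smooth proper
one-vertex datum `Π_v = Π_𝔾 = Π_I = Π_H` (here the dihedral group of order `6`, discrete), no edges;
an instance of `prop13v_of_vertSub_eq`, `prop13vi_of_vertSub_eq`, `prop13vii_of_isEmpty`.  (A
consistency certificate for the cell's hypotheses `(h : X.Prop13v) …`; it models no particular
curve.) [cite: MochizukiAbsTopII2013, Prop 1.3 (v) p.12] -/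
theorem exists_prop13v_prop13vi_prop13vii :
    ∃ X : DPSCData.{u}, Nontrivial X.PiH ∧ Nonempty X.Vert ∧
      X.Prop13v ∧ X.Prop13vi ∧ X.Prop13vii := by
  haveI : DiscreteTopology
      (ProfiniteGrp.ofFiniteGrp (FiniteGrp.of (ULift.{u} (DihedralGroup 3)))) := ⟨rfl⟩
  refine ⟨{ PiH := ProfiniteGrp.ofFiniteGrp (FiniteGrp.of (ULift.{u} (DihedralGroup 3))),
            PiG := ⊤, normal_PiG := inferInstance, isClosed_PiG := isClosed_discrete _,
            PiI := ⊤, PiG_le_PiI := le_rfl, normal_PiI := inferInstance,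
            Vert := PUnit.{u + 1}, Node := PEmpty.{u + 1}, Cusp := PEmpty.{u + 1},
            vertSub := fun _ => ⊤, vertSub_le := fun _ => le_rfl,
            nodeSub := fun e => e.elim, nodeSub_le := fun e => e.elim,
            cuspSub := fun e => e.elim, cuspSub_le := fun e => e.elim,
            nodeAbuts := fun e _ => e.elim, cuspVert := fun e => e.elim }, ?_, ⟨PUnit.unit⟩,
    ?_, ?_, ?_⟩
  · exact ⟨⟨ULift.up (DihedralGroup.r 1), ULift.up (DihedralGroup.sr 0), fun h =>
      absurd (ULift.up_inj.mp h) (by decide)⟩⟩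
  · exact prop13v_of_vertSub_eq _ (fun _ => rfl)
  · exact prop13vi_of_vertSub_eq _ (fun _ _ => rfl) (fun _ => rfl)
  · exact prop13vii_of_isEmpty _ inferInstance inferInstance

/-! ## The universal closures are FALSE (the rows are hypotheses on data) -/

/-- **F-0278: the universal closure of `DPSCData.Prop13v` is FALSE.**  Witness: `Π_H = Π_I = Π_𝔾 =`
the dihedral group of order `6` (discrete), one vertex with `Π_v := 1`; then `D_v = N_{Π_H}(1) = Π_H`
and the clause "`D_v ∩ Π_𝔾 = Π_v`" reads `Π_𝔾 = 1`, false.  (For data arising from a stable log curve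
this clause is [CombGC] Prop 1.2 (ii) — an INPUT, cf. `DPSCData.prop13v_of_inputs`.)
[cite: MochizukiAbsTopII2013, Prop 1.3 (v) p.12] -/
theorem not_forall_prop13v : ¬ ∀ X : DPSCData.{u}, X.Prop13v := by
  intro hall
  haveI : DiscreteTopology
      (ProfiniteGrp.ofFiniteGrp (FiniteGrp.of (ULift.{u} (DihedralGroup 3)))) := ⟨rfl⟩
  let X : DPSCData.{u} :=
    { PiH := ProfiniteGrp.ofFiniteGrp (FiniteGrp.of (ULift.{u} (DihedralGroup 3))),
      PiG := ⊤, normal_PiG := inferInstance, isClosed_PiG := isClosed_discrete _,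
      PiI := ⊤, PiG_le_PiI := le_rfl, normal_PiI := inferInstance,
      Vert := PUnit.{u + 1}, Node := PEmpty.{u + 1}, Cusp := PEmpty.{u + 1},
      vertSub := fun _ => ⊥, vertSub_le := fun _ => bot_le,
      nodeSub := fun e => e.elim, nodeSub_le := fun e => e.elim,
      cuspSub := fun e => e.elim, cuspSub_le := fun e => e.elim,
      nodeAbuts := fun e _ => e.elim, cuspVert := fun e => e.elim }
  have h4 : X.Dv PUnit.unit ⊓ X.PiG = X.vertSub PUnit.unit := (hall X PUnit.unit).2.2.2.1
  have hD : X.Dv PUnit.unit = ⊤ := by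
    unfold DPSCData.Dv
    exact Subgroup.normalizer_eq_top (H := (⊥ : Subgroup X.PiH))
  rw [hD, top_inf_eq] at h4
  have hmem : (ULift.up (DihedralGroup.r 1) : X.PiH) ∈ X.vertSub PUnit.unit :=
    h4 ▸ Subgroup.mem_top _
  change (ULift.up (DihedralGroup.r 1) : ULift.{u} (DihedralGroup 3)) ∈ (⊥ : Subgroup _) at hmem
  rw [Subgroup.mem_bot] at hmem
  exact absurd (ULift.up_inj.mp hmem) (by decide)

/-- **F-0279: the universal closure of `DPSCData.Prop13vi` is FALSE.**  Witness: `Π_H =` the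
dihedral group of order `6` with the DISCRETE topology and two vertices `v ≠ w`; then `D_v` is open
in `Π_H`, against "if `𝔾` has more than one vertex, then `D_v` is not open in `Π_H`".  (For data
arising from a singular stable log curve `Π_H` is an infinite profinite group and this clause is
[CombGC] Prop 1.2 — an INPUT, cf. `DPSCData.prop13vi_of_inputs` / `not_isOpen_Dv`.)
[cite: MochizukiAbsTopII2013, Prop 1.3 (vi) p.12] -/
theorem not_forall_prop13vi : ¬ ∀ X : DPSCData.{u}, X.Prop13vi := by
  intro hall
  haveI : DiscreteTopology
      (ProfiniteGrp.ofFiniteGrp (FiniteGrp.of (ULift.{u} (DihedralGroup 3)))) := ⟨rfl⟩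
  let X : DPSCData.{u} :=
    { PiH := ProfiniteGrp.ofFiniteGrp (FiniteGrp.of (ULift.{u} (DihedralGroup 3))),
      PiG := ⊤, normal_PiG := inferInstance, isClosed_PiG := isClosed_discrete _,
      PiI := ⊤, PiG_le_PiI := le_rfl, normal_PiI := inferInstance,
      Vert := ULift.{u} Bool, Node := PEmpty.{u + 1}, Cusp := PEmpty.{u + 1},
      vertSub := fun _ => ⊥, vertSub_le := fun _ => bot_le,
      nodeSub := fun e => e.elim, nodeSub_le := fun e => e.elim,
      cuspSub := fun e => e.elim, cuspSub_le := fun e => e.elim,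
      nodeAbuts := fun e _ => e.elim, cuspVert := fun e => e.elim }
  have h2 : (∃ w : X.Vert, w ≠ ULift.up true) → ¬ IsOpen (X.Dv (ULift.up true) : Set X.PiH) :=
    (hall X (ULift.up true)).2
  refine h2 ⟨ULift.up false, fun h => ?_⟩ (isOpen_discrete _)
  exact absurd (ULift.up_inj.mp h) (by decide)

/-- **F-0280: the universal closure of `DPSCData.Prop13vii` is FALSE.**  Witness: `Π_H = Π_I = Π_𝔾 =`
the dihedral group of order `6` (discrete), one node `e` with `Π_e := Π_𝔾`; then
`D_e ∩ Π_I = N_{Π_H}(Π_𝔾) = Π_H ∋ r` (the rotation) while `I_e = Z_{Π_I}(Π_𝔾)` is the centre, which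
does not contain `r` (`r·s ≠ s·r`), against the node clause "`I_e = D_e ∩ Π_I`".  (For data arising
from a stable log curve, `Π_e ≅ Ẑ^Σ(1)` and the clause follows from Prop 1.3 (ii) + [CombGC]
Prop 1.2 (ii) — INPUTS, cf. `DPSCData.prop13vii_of_inputs`.) [cite: MochizukiAbsTopII2013, Prop 1.3 (vii) p.12] -/
theorem not_forall_prop13vii : ¬ ∀ X : DPSCData.{u}, X.Prop13vii := by
  intro hall
  haveI : DiscreteTopology
      (ProfiniteGrp.ofFiniteGrp (FiniteGrp.of (ULift.{u} (DihedralGroup 3)))) := ⟨rfl⟩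
  let X : DPSCData.{u} :=
    { PiH := ProfiniteGrp.ofFiniteGrp (FiniteGrp.of (ULift.{u} (DihedralGroup 3))),
      PiG := ⊤, normal_PiG := inferInstance, isClosed_PiG := isClosed_discrete _,
      PiI := ⊤, PiG_le_PiI := le_rfl, normal_PiI := inferInstance,
      Vert := PUnit.{u + 1}, Node := PUnit.{u + 1}, Cusp := PEmpty.{u + 1},
      vertSub := fun _ => ⊤, vertSub_le := fun _ => le_rfl,
      nodeSub := fun _ => ⊤, nodeSub_le := fun _ => le_rfl,
      cuspSub := fun e => e.elim, cuspSub_le := fun e => e.elim,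
      nodeAbuts := fun _ _ => True, cuspVert := fun e => e.elim }
  have h3 : X.IvNode PUnit.unit = X.DvNode PUnit.unit ⊓ X.PiI := ((hall X).1 PUnit.unit).2.2
  have hr : (ULift.up (DihedralGroup.r 1) : X.PiH) ∈ X.DvNode PUnit.unit ⊓ X.PiI :=
    ⟨Subgroup.le_normalizer (Subgroup.mem_top _), Subgroup.mem_top _⟩
  rw [← h3] at hr
  have hc := (Subgroup.mem_centralizer_iff.mp hr.1) (ULift.up (DihedralGroup.sr 0))
    (Subgroup.mem_top _)
  change (ULift.up (DihedralGroup.sr 0 * DihedralGroup.r 1) : ULift.{u} (DihedralGroup 3)) =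
    ULift.up (DihedralGroup.r 1 * DihedralGroup.sr 0) at hc
  exact absurd (ULift.up_inj.mp hc) (by decide)

end DPSCData

end Literature.AnabelianGeometry.AbsoluteAnabelian
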